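import Mathlib
import HarnessLib
import Summits.CriticalPhenomena.PercolationContinuityZ3.Theses.PercTreeValue
import Summits.CriticalPhenomena.PercolationContinuityZ3.Theorems.PercTreeValueTetrahedronDisjointCoexistenceStubPairSymm
import Summits.CriticalPhenomena.PercolationContinuityZ3.Theorems.PercTreeValueTetrahedronDisjointCoexistenceStubShellDecoupling
import Summits.CriticalPhenomena.PercolationContinuityZ3.Theorems.PercTreeValueTetrahedronDisjointCoexistenceStubShiftBoxCrossing
import Summits.CriticalPhenomena.PercolationContinuityZ3.Theorems.PercTreeValueTetrahedronDisjointCoexistenceStubMirrorRestrict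
import Summits.CriticalPhenomena.PercolationContinuityZ3.Theorems.PercTreeValueAssemblyViaDisjointCoexistence
import Literature.Probability.Percolation.TwoPointFunction
import Literature.Probability.Percolation.TreeGraphBound
import Literature.Probability.Percolation.RSW
import Literature.Probability.LatticeModels.ThermodynamicLimit

/-!
# Route PercTreeValue — transfer C for the crux `TetrahedronDisjointCoexistence` (stmt-CriticalPhenomena-7798):
# closed-shell decoupling — X_B ∧ core restriction ⇒ the crux

Line `Sketch` (lead prover-line-stmt-CriticalPhenomena-7798-c1-0; card `closed-shell-barrier-dichotomy`, reshaped). With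
`a_r = (r,r,0)`, `b_r = (r,0,r)`, `c_r = (0,r,r)`, `k = ⌊r/8⌋`, `K = k + 1`, `v_r = (4K, 4K, −4K)`, `n_r = 5K`:

* `Core_r := [−k, r+k]² × [−(r+k), k]` ∋ `0, a_r` (depth `k`), `Outer_r := v_r + B(10K)` (top face at height `6K`),
  `W_r := {x | 6K + 1 ≤ x₂}` ∋ `b_r, c_r` (`r ≥ 56`), `Shell(R,R')` := no open path of `R' ∖ R` from a vertex adjacent to `R`
  to a vertex adjacent to `R'ᶜ`.
* `stub_cruxOfShellRestriction` (registered transfer stub S6 of `Cruxes/TetrahedronDisjointCoexistence/Lines/Sketch.lean`):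
  the HYPOTHESES are X_B = `PercAnnulusCrossing.CritAnnulusNonCrossing` (stmt-CriticalPhenomena-0846, verbatim: at `p_c`, with
  probability `≥ c_X` no open path inside `B(2n)` joins `B(n)` to `∂B(2n)`) and CORE RESTRICTION
  (`P(0 ↔ a_r inside Core_r) ≥ c τ(0,a_r)`); the CONCLUSION is the crux formula with `δ = c_X c²`:
  `P(0 ↔_{Core} a_r) · P(Shell(Core, Outer)) · P(b_r ↔_{W} c_r) ≤ P(target)` (landed `stub_shellDecoupling`),
  `Shell(Core, Outer) ⊇ (v_r + X_B-event(n_r))ᶜ` (`transferC_shell_superset_compl`) and `P(v_r + X_B(n)) = P(X_B(n)) ≤ 1 − c_X`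
  (landed `stub_shiftBoxCrossing`), `P(b_r ↔_{W_r} c_r) = P(0 ↔_{x₂ ≤ r − 6K − 1} a_r) ≥ P(0 ↔_{Core_r} a_r) ≥ c τ(0,a_r)`
  (landed `stub_mirrorRestrict`, `openConnIn_mono`), `τ(b_r,c_r) = τ(0,a_r)` (landed `stub_pairSymm`).
* `tetrahedronDisjointCoexistence_of_annulusNonCrossing_of_coreRestriction` — the same, concluded BY NAME.
* `percolationContinuityZ3_of_annulusNonCrossing_of_coreRestriction` — composed with `AssemblyViaDisjointCoexistence_proof`:
  formal record that the pair is continuity-strength (X_B alone already is, via route `PercAnnulusCrossing`).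

No new definitions; hypotheses are spelled out over tree declarations exactly as the registered open stubs
`stub_annulusNonCrossing`, `stub_coreRestriction` of `Lines/Sketch.lean`.
-/

noncomputable section

namespace Summit.CriticalPhenomena.PercolationContinuityZ3.Theorems.TetrahedronDisjointCoexistence

open MeasureTheory
open Literature.Probability.Percolation Literature.Probability.LatticeModels

/-- Complement of an X_B-type crossing event lies in the shell event: an open crossing of `R' ∖ R` from a vertex `u`
adjacent to `R` (so `u ∈ I` by `hI`) to a vertex adjacent to `R'ᶜ` is in particular an open path inside `R'` from `I`
to the inner vertex boundary of `R'`. -/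
theorem transferC_shell_superset_compl {V : Type*} (G : SimpleGraph V) {R R' I : Set V}
    (hI : ∀ u, u ∉ R → (∃ z ∈ R, G.Adj u z) → u ∈ I) :
    {ω : BondConfig V | ∃ x ∈ I, ∃ y ∈ R', (∃ z ∉ R', G.Adj y z) ∧ ω ∈ openConnIn R' x y}ᶜ ⊆
      {ω | ∀ u ∈ R' \ R, ∀ w ∈ R' \ R, (∃ z ∈ R, G.Adj u z) → (∃ z ∉ R', G.Adj w z) →
        ω ∉ openConnIn (R' \ R) u w} := by
  intro ω hω u hu w hw huR hwR hconn
  apply hω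
  exact ⟨u, hI u hu.2 huR, w, hw.1, hwR, openConnIn_mono (fun _ h => h.1) u w hconn⟩

/-- **Transfer C (registered stub S6 of line `Sketch`).** X_B (`PercAnnulusCrossing.CritAnnulusNonCrossing`, verbatim) and
core restriction at relative depth `1/8` give the crux `TetrahedronDisjointCoexistence` — stated as its formula, unfolded —
with `δ = c_X · c²` and `r₀ ↦ max r₀ 56`, by closed-shell decoupling (`stub_shellDecoupling`) with the shell supplied by the
translated X_B annulus `v_r + (B(10K) ∖ B(5K))` around `Core_r` (`stub_shiftBoxCrossing`), the rotoreflection `φ_r`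
(`stub_mirrorRestrict`, `stub_pairSymm`) and monotonicity of restricted connections in the region. -/
theorem stub_cruxOfShellRestriction
    (hXB : ∃ c : ℝ, 0 < c ∧ ∀ n : ℕ, 1 ≤ n →
      (bondPercolation (zdGraph 3) (criticalProbI 3)).real
          {ω | ∃ x ∈ box 3 n, ∃ y ∈ innerBoundary (zdGraph 3) (box 3 (2 * n)),
            ω ∈ openConnIn ↑(box 3 (2 * n)) x y} ≤ 1 - c)
    (hCore : ∃ c : ℝ, 0 < c ∧ ∃ r₀ : ℕ, ∀ r : ℕ, r₀ ≤ r →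
      c * tau 3 (criticalProbI 3) 0 ![(r : ℤ), (r : ℤ), 0] ≤
        (bondPercolation (zdGraph 3) (criticalProbI 3)).real
          (openConnIn
            {x : Site 3 | -((r : ℤ) / 8) ≤ x 0 ∧ x 0 ≤ (r : ℤ) + (r : ℤ) / 8 ∧
              -((r : ℤ) / 8) ≤ x 1 ∧ x 1 ≤ (r : ℤ) + (r : ℤ) / 8 ∧
              -((r : ℤ) + (r : ℤ) / 8) ≤ x 2 ∧ x 2 ≤ (r : ℤ) / 8}
            (0 : Site 3) ![(r : ℤ), (r : ℤ), 0])) :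
    ∃ δ : ℝ, 0 < δ ∧ ∃ r₀ : ℕ, ∀ r : ℕ, r₀ ≤ r →
      δ * tau 3 (criticalProbI 3) 0 ![(r : ℤ), (r : ℤ), 0] *
          tau 3 (criticalProbI 3) ![(r : ℤ), 0, (r : ℤ)] ![0, (r : ℤ), (r : ℤ)] ≤
        (bondPercolation (zdGraph 3) (criticalProbI 3)).real
          (openConn 0 ![(r : ℤ), (r : ℤ), 0] ∩ openConn ![(r : ℤ), 0, (r : ℤ)] ![0, (r : ℤ), (r : ℤ)] ∩
            (openConn (0 : Site 3) ![(r : ℤ), 0, (r : ℤ)])ᶜ) := by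
  obtain ⟨cX, hcX, hX⟩ := hXB
  obtain ⟨c, hc, r₁, hC⟩ := hCore
  refine ⟨cX * c ^ 2, by positivity, max r₁ 56, fun r hr => ?_⟩
  have hr₁ : r₁ ≤ r := le_trans (le_max_left _ _) hr
  have hr56 : 56 ≤ r := le_trans (le_max_right _ _) hr
  -- the objects
  set k : ℤ := (r : ℤ) / 8 with hk
  set Core : Set (Site 3) :=
    {x : Site 3 | -((r : ℤ) / 8) ≤ x 0 ∧ x 0 ≤ (r : ℤ) + (r : ℤ) / 8 ∧
      -((r : ℤ) / 8) ≤ x 1 ∧ x 1 ≤ (r : ℤ) + (r : ℤ) / 8 ∧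
      -((r : ℤ) + (r : ℤ) / 8) ≤ x 2 ∧ x 2 ≤ (r : ℤ) / 8} with hCore_def
  set v : Site 3 := ![4 * (k + 1), 4 * (k + 1), -(4 * (k + 1))] with hv
  set n : ℕ := 5 * (r / 8 + 1) with hn
  have hn_cast : (n : ℤ) = 5 * (k + 1) := by
    simp only [hn, hk]; push_cast; ring
  have hn1 : 1 ≤ n := by omega
  set Outer : Set (Site 3) := {u : Site 3 | u - v ∈ box 3 (2 * n)} with hOuter
  set Inner : Set (Site 3) := {u : Site 3 | u - v ∈ box 3 n} with hInner
  set W : Set (Site 3) := {x : Site 3 | 6 * (k + 1) + 1 ≤ x 2} with hW_def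
  have hv0 : v 0 = 4 * (k + 1) := rfl
  have hv1 : v 1 = 4 * (k + 1) := rfl
  have hv2 : v 2 = -(4 * (k + 1)) := rfl
  -- membership unfolding
  have mem_Outer : ∀ u : Site 3, u ∈ Outer ↔
      ∀ i : Fin 3, -((2 * n : ℕ) : ℤ) ≤ u i - v i ∧ u i - v i ≤ ((2 * n : ℕ) : ℤ) := by
    intro u; simp only [hOuter, Set.mem_setOf_eq, mem_box, Pi.sub_apply]
  have mem_Inner : ∀ u : Site 3, u ∈ Inner ↔
      ∀ i : Fin 3, -(n : ℤ) ≤ u i - v i ∧ u i - v i ≤ (n : ℤ) := by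
    intro u; simp only [hInner, Set.mem_setOf_eq, mem_box, Pi.sub_apply]
  have mem_Core : ∀ u : Site 3, u ∈ Core ↔
      -((r : ℤ) / 8) ≤ u 0 ∧ u 0 ≤ (r : ℤ) + (r : ℤ) / 8 ∧
      -((r : ℤ) / 8) ≤ u 1 ∧ u 1 ≤ (r : ℤ) + (r : ℤ) / 8 ∧
      -((r : ℤ) + (r : ℤ) / 8) ≤ u 2 ∧ u 2 ≤ (r : ℤ) / 8 := fun u => Iff.rfl
  have h2n : ((2 * n : ℕ) : ℤ) = 10 * (k + 1) := by push_cast; rw [hn_cast]; ring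
  -- geometry (`r ≥ 56` gives `k ≥ 7`, and `8k ≤ r ≤ 8k + 7`)
  have hRR' : Core ⊆ Outer := by
    intro u hu
    rw [mem_Core] at hu
    rw [mem_Outer]
    intro i
    fin_cases i <;> simp only [Fin.zero_eta, Fin.mk_one, Fin.reduceFinMk, Fin.isValue, hv0, hv1, hv2, h2n] <;> omega
  have hN : ∀ x ∈ Core, ∀ y, (zdGraph 3).Adj x y → y ∈ Outer := by
    intro x hx y hxy
    rw [mem_Core] at hx
    rw [mem_Outer]
    have h0 := zdGraph_adj_apply_le hxy 0
    have h1 := zdGraph_adj_apply_le hxy 1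
    have h2 := zdGraph_adj_apply_le hxy 2
    intro i
    fin_cases i <;> simp only [Fin.zero_eta, Fin.mk_one, Fin.reduceFinMk, Fin.isValue, hv0, hv1, hv2, h2n] <;> omega
  have hI : ∀ u, u ∉ Core → (∃ z ∈ Core, (zdGraph 3).Adj u z) → u ∈ Inner := by
    rintro u - ⟨z, hz, huz⟩
    rw [mem_Core] at hz
    rw [mem_Inner]
    have h0 := zdGraph_adj_apply_le huz 0
    have h1 := zdGraph_adj_apply_le huz 1
    have h2 := zdGraph_adj_apply_le huz 2
    intro i
    fin_cases i <;> simp only [Fin.zero_eta, Fin.mk_one, Fin.reduceFinMk, Fin.isValue, hv0, hv1, hv2, hn_cast] <;> omega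
  have hWdisj : Disjoint Outer W := by
    rw [Set.disjoint_left]
    intro u hu huW
    rw [mem_Outer] at hu
    have h2 := hu 2
    simp only [hW_def, Set.mem_setOf_eq] at huW
    rw [hv2, h2n] at h2
    omega
  have hCoreW : Core ⊆ {x : Site 3 | x 2 ≤ (r : ℤ) - (6 * (k + 1) + 1)} := by
    intro u hu
    rw [mem_Core] at hu
    simp only [Set.mem_setOf_eq]
    omega
  -- S1: decoupling
  have hdec := stub_shellDecoupling (zdGraph 3) (criticalProbI 3) hRR' hN hWdisj
    (0 : Site 3) ![(r : ℤ), (r : ℤ), 0] ![(r : ℤ), 0, (r : ℤ)] ![0, (r : ℤ), (r : ℤ)]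
  -- S2 + X_B: the shell has probability ≥ cX
  have hShell : cX ≤ (bondPercolation (zdGraph 3) (criticalProbI 3)).real
      {ω | ∀ u ∈ Outer \ Core, ∀ w ∈ Outer \ Core, (∃ z ∈ Core, (zdGraph 3).Adj u z) →
        (∃ z ∉ Outer, (zdGraph 3).Adj w z) → ω ∉ openConnIn (Outer \ Core) u w} := by
    have hsup := transferC_shell_superset_compl (zdGraph 3) (R := Core) (R' := Outer) (I := Inner) hI
    have hXBn := hX n hn1
    have hshift := stub_shiftBoxCrossing (criticalProbI 3) v n
    have hev : {ω : BondConfig (Site 3) | ∃ x ∈ Inner, ∃ y ∈ Outer,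
        (∃ z ∉ Outer, (zdGraph 3).Adj y z) ∧ ω ∈ openConnIn Outer x y} =
        {ω | ∃ x : Site 3, x - v ∈ box 3 n ∧ ∃ y : Site 3, y - v ∈ box 3 (2 * n) ∧
          (∃ z : Site 3, z - v ∉ box 3 (2 * n) ∧ (zdGraph 3).Adj y z) ∧
          ω ∈ openConnIn {u : Site 3 | u - v ∈ box 3 (2 * n)} x y} := by
      ext ω
      constructor
      · rintro ⟨x, hx, y, hy, ⟨z, hz, hyz⟩, hω⟩
        exact ⟨x, hx, y, hy, ⟨z, hz, hyz⟩, hω⟩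
      · rintro ⟨x, hx, y, hy, ⟨z, hz, hyz⟩, hω⟩
        exact ⟨x, hx, y, hy, ⟨z, hz, hyz⟩, hω⟩
    have hunion : (bondPercolation (zdGraph 3) (criticalProbI 3)).real Set.univ ≤
        (bondPercolation (zdGraph 3) (criticalProbI 3)).real
          {ω | ∀ u ∈ Outer \ Core, ∀ w ∈ Outer \ Core, (∃ z ∈ Core, (zdGraph 3).Adj u z) →
            (∃ z ∉ Outer, (zdGraph 3).Adj w z) → ω ∉ openConnIn (Outer \ Core) u w} +
        (bondPercolation (zdGraph 3) (criticalProbI 3)).real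
          {ω : BondConfig (Site 3) | ∃ x ∈ Inner, ∃ y ∈ Outer,
            (∃ z ∉ Outer, (zdGraph 3).Adj y z) ∧ ω ∈ openConnIn Outer x y} := by
      refine le_trans (measureReal_mono ?_) (measureReal_union_le _ _)
      intro ω _
      by_cases hω : ω ∈ {ω : BondConfig (Site 3) | ∃ x ∈ Inner, ∃ y ∈ Outer,
          (∃ z ∉ Outer, (zdGraph 3).Adj y z) ∧ ω ∈ openConnIn Outer x y}
      · exact Or.inr hω
      · exact Or.inl (hsup hω)
    rw [probReal_univ, hev, hshift] at hunion
    linarith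
  -- S3 + core restriction: the two restricted connections
  have hA := hC r hr₁
  have hB : c * tau 3 (criticalProbI 3) 0 ![(r : ℤ), (r : ℤ), 0] ≤
      (bondPercolation (zdGraph 3) (criticalProbI 3)).real
        (openConnIn W (![(r : ℤ), 0, (r : ℤ)] : Site 3) ![0, (r : ℤ), (r : ℤ)]) := by
    have hm := stub_mirrorRestrict (criticalProbI 3) r (6 * (k + 1) + 1)
    rw [hm]
    exact le_trans hA (measureReal_mono (openConnIn_mono hCoreW _ _))
  -- pair symmetry for τ
  obtain ⟨hτ, -⟩ := stub_pairSymm (criticalProbI 3) r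
  have hτ' : tau 3 (criticalProbI 3) ![(r : ℤ), 0, (r : ℤ)] ![0, (r : ℤ), (r : ℤ)] =
      tau 3 (criticalProbI 3) 0 ![(r : ℤ), (r : ℤ), 0] := by
    rw [tau_def, tau_def]; exact hτ
  rw [hτ']
  have hτnn : 0 ≤ tau 3 (criticalProbI 3) 0 ![(r : ℤ), (r : ℤ), 0] := tau_nonneg _ _ _
  have hcτ : 0 ≤ c * tau 3 (criticalProbI 3) 0 ![(r : ℤ), (r : ℤ), 0] := by positivity
  calc cX * c ^ 2 * tau 3 (criticalProbI 3) 0 ![(r : ℤ), (r : ℤ), 0] *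
        tau 3 (criticalProbI 3) 0 ![(r : ℤ), (r : ℤ), 0]
      = (c * tau 3 (criticalProbI 3) 0 ![(r : ℤ), (r : ℤ), 0]) * cX *
          (c * tau 3 (criticalProbI 3) 0 ![(r : ℤ), (r : ℤ), 0]) := by ring
    _ ≤ (bondPercolation (zdGraph 3) (criticalProbI 3)).real
            (openConnIn Core (0 : Site 3) ![(r : ℤ), (r : ℤ), 0]) *
          (bondPercolation (zdGraph 3) (criticalProbI 3)).real
            {ω | ∀ u ∈ Outer \ Core, ∀ w ∈ Outer \ Core, (∃ z ∈ Core, (zdGraph 3).Adj u z) →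
              (∃ z ∉ Outer, (zdGraph 3).Adj w z) → ω ∉ openConnIn (Outer \ Core) u w} *
          (bondPercolation (zdGraph 3) (criticalProbI 3)).real
            (openConnIn W (![(r : ℤ), 0, (r : ℤ)] : Site 3) ![0, (r : ℤ), (r : ℤ)]) := by
        refine mul_le_mul (mul_le_mul hA hShell hcX.le measureReal_nonneg) hB hcτ
          (mul_nonneg measureReal_nonneg measureReal_nonneg)
    _ ≤ _ := hdec

/-- **X_B ∧ core restriction ⇒ `TetrahedronDisjointCoexistence`**, concluded by name (composition of line `Sketch`). -/
theorem tetrahedronDisjointCoexistence_of_annulusNonCrossing_of_coreRestriction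
    (hXB : ∃ c : ℝ, 0 < c ∧ ∀ n : ℕ, 1 ≤ n →
      (bondPercolation (zdGraph 3) (criticalProbI 3)).real
          {ω | ∃ x ∈ box 3 n, ∃ y ∈ innerBoundary (zdGraph 3) (box 3 (2 * n)),
            ω ∈ openConnIn ↑(box 3 (2 * n)) x y} ≤ 1 - c)
    (hCore : ∃ c : ℝ, 0 < c ∧ ∃ r₀ : ℕ, ∀ r : ℕ, r₀ ≤ r →
      c * tau 3 (criticalProbI 3) 0 ![(r : ℤ), (r : ℤ), 0] ≤
        (bondPercolation (zdGraph 3) (criticalProbI 3)).real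
          (openConnIn
            {x : Site 3 | -((r : ℤ) / 8) ≤ x 0 ∧ x 0 ≤ (r : ℤ) + (r : ℤ) / 8 ∧
              -((r : ℤ) / 8) ≤ x 1 ∧ x 1 ≤ (r : ℤ) + (r : ℤ) / 8 ∧
              -((r : ℤ) + (r : ℤ) / 8) ≤ x 2 ∧ x 2 ≤ (r : ℤ) / 8}
            (0 : Site 3) ![(r : ℤ), (r : ℤ), 0])) :
    Theses.PercTreeValue.TetrahedronDisjointCoexistence := by
  unfold Theses.PercTreeValue.TetrahedronDisjointCoexistence
  exact stub_cruxOfShellRestriction hXB hCore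

/-- X_B together with core restriction settles the conjunct `θ(p_c(ℤ³)) = 0` (through the landed
`AssemblyViaDisjointCoexistence_proof`); X_B alone already does so through route `PercAnnulusCrossing` — this records that
the pair, hence the line's open content, is continuity-strength. -/
theorem percolationContinuityZ3_of_annulusNonCrossing_of_coreRestriction
    (hXB : ∃ c : ℝ, 0 < c ∧ ∀ n : ℕ, 1 ≤ n →
      (bondPercolation (zdGraph 3) (criticalProbI 3)).real
          {ω | ∃ x ∈ box 3 n, ∃ y ∈ innerBoundary (zdGraph 3) (box 3 (2 * n)),
            ω ∈ openConnIn ↑(box 3 (2 * n)) x y} ≤ 1 - c)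
    (hCore : ∃ c : ℝ, 0 < c ∧ ∃ r₀ : ℕ, ∀ r : ℕ, r₀ ≤ r →
      c * tau 3 (criticalProbI 3) 0 ![(r : ℤ), (r : ℤ), 0] ≤
        (bondPercolation (zdGraph 3) (criticalProbI 3)).real
          (openConnIn
            {x : Site 3 | -((r : ℤ) / 8) ≤ x 0 ∧ x 0 ≤ (r : ℤ) + (r : ℤ) / 8 ∧
              -((r : ℤ) / 8) ≤ x 1 ∧ x 1 ≤ (r : ℤ) + (r : ℤ) / 8 ∧
              -((r : ℤ) + (r : ℤ) / 8) ≤ x 2 ∧ x 2 ≤ (r : ℤ) / 8}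
            (0 : Site 3) ![(r : ℤ), (r : ℤ), 0])) :
    _root_.PercolationContinuityZ3 := by
  have hA := AssemblyViaDisjointCoexistence_proof
  unfold Theses.PercTreeValue.AssemblyViaDisjointCoexistence at hA
  exact hA (tetrahedronDisjointCoexistence_of_annulusNonCrossing_of_coreRestriction hXB hCore)

end Summit.CriticalPhenomena.PercolationContinuityZ3.Theorems.TetrahedronDisjointCoexistence

end
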